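import Summits.BirchSwinnertonDyer.BirchSwinnertonDyer.Theorems.ShaPrimaryTransferFiniteShaComponentTransferSelmerCubicKillLocal
import HarnessLib

/-!
# BirchSwinnertonDyer — SEL2CUBIC kill layer, local half (2): the locally trivial case `(1 ⊗ z)·ρ² = 1`

HONEST FRAMING: route `ShaPrimaryTransfer`, seat `bsd-line-spt-p1` (g30), `--supports` item T =
`FiniteShaComponentTransfer` (stmt-22356), UNCHANGED (conjecture-grade at corank ≥ 2). BSD in rank ≥ 2 is NOT
proved by any of this. THEOREMS ONLY.

Companion of `…SelmerCubicKillLocal`: a `2`-Selmer class whose restriction to `ℚ_p` VANISHES makes the class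
`z` a square in every `K_w`, `w ∣ p`; the corresponding point of the `2`-covering `z·r² + n²θ ∈ ℚ_p` is the one
«at infinity», `n = 0` (`z·r² ∈ ℚ_p`). This file gives the `n = 0` twins of the three steps:
`killQ_eq_zero_of_tmul_sq_eq_one` (coordinates of `(1 ⊗ z)·ρ² = 1` give `killQ (c₀, c₁, c₂, 0) = 0`,
`(c₀, c₁, c₂) ≠ 0`), `exists_tmul_sq_eq_one_of_forall_extension` (glue along `ℚ_[p] ⊗_ℚ K ≅ ∏ K_w`),
`exists_primitive_killQ_dvd_of_forall_extension_one` (for every `N`, a `p`-primitive integer vector with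
`p^N ∣ Q₁, Q₂`). [cite: Cassels1991LecturesEllipticCurves, §15] [cite: CremonaAlgorithms1997, §3.6]
[cite: CasselsFrohlichANT1967, Ch. II §10 Theorem (10.2)]
-/

-- single-conjunct summit: `Summit.BirchSwinnertonDyer.BirchSwinnertonDyer.…` repeats the name by design
set_option linter.dupNamespace false

noncomputable section

open scoped TensorProduct NumberField

namespace Summit.BirchSwinnertonDyer.BirchSwinnertonDyer.Theorems.ShaPrimaryTransferSelmerCubicKill

open Summit.BirchSwinnertonDyer.BirchSwinnertonDyer.Rank2Observatory
open Summit.BirchSwinnertonDyer.BirchSwinnertonDyer.Rank2Observatory.TwoDescKill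
open Summit.BirchSwinnertonDyer.BirchSwinnertonDyer.Rank2Observatory.TwoDescCubic

/-! ## The locally trivial case: `(1 ⊗ z)·ρ² = 1` (the class of `z` is a square at every `w ∣ p`)

A `2`-Selmer class whose restriction to `ℚ_p` vanishes makes `z` a square in every `K_w`, `w ∣ p`; the
corresponding point of the `2`-covering is «at infinity» (`n = 0`): `z·r² ∈ ℚ_p`, i.e. `killQ (r, 0) = 0`. -/

section One

open Literature.NumberTheory.NumberFields Literature.NumberTheory.AdelicBaseChange IsDedekindDomain NumberField
  Module Polynomial

variable {K : Type} [Field K] [NumberField K] {a b c : ℤ} {α : K} {p : ℕ} [Fact p.Prime]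

/-- **The `α`, `α²` coordinates of `(1 ⊗ z)·ρ² = 1`**: the `ℚ_[p]`-coordinates `(c₀, c₁, c₂) ≠ 0` of `ρ` on
`1 ⊗ αⁱ` satisfy `killQ (c₀, c₁, c₂, 0) = 0` over `ℚ_[p]` (the `α` and `α²` coordinates of `z·ρ²` vanish).
[cite: Cassels1991LecturesEllipticCurves, §15] -/
theorem killQ_eq_zero_of_tmul_sq_eq_one (hirr : Irreducible (MonicCubic.polyQ a b c))
    (hα : aeval α (MonicCubic.poly a b c) = 0) (h3 : finrank ℚ K = 3)
    (z : ℤ × ℤ × ℤ) (t₁ t₂ : ℤ) (ρ : ℚ_[p] ⊗[ℚ] K)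
    (h : ((1 : ℚ_[p]) ⊗ₜ[ℚ] evZ α z) * ρ ^ 2 = 1) :
    ∃ c₀ c₁ c₂ : ℚ_[p], ((c₀, c₁, c₂, (0 : ℚ_[p])) : ℚ_[p] × ℚ_[p] × ℚ_[p] × ℚ_[p]) ≠ 0 ∧
      killQ (a : ℚ_[p]) (b : ℚ_[p]) (c : ℚ_[p]) ((z.1 : ℚ_[p]), (z.2.1 : ℚ_[p]), (z.2.2 : ℚ_[p]))
        (t₁ : ℚ_[p]) (t₂ : ℚ_[p]) (c₀, c₁, c₂, 0) = 0 := by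
  set B' := Algebra.TensorProduct.basis ℚ_[p] (MonicCubic.basis hirr hα h3) with hB'
  set ι := algebraMap ℚ_[p] (ℚ_[p] ⊗[ℚ] K) with hι
  set αR : ℚ_[p] ⊗[ℚ] K := (1 : ℚ_[p]) ⊗ₜ[ℚ] α with hαR
  have hαR3 : αR ^ 3 + (a : ℚ_[p] ⊗[ℚ] K) * αR ^ 2 + (b : ℚ_[p] ⊗[ℚ] K) * αR + (c : ℚ_[p] ⊗[ℚ] K) = 0 := by
    have h1 := congrArg (Algebra.TensorProduct.includeRight (R := ℚ) (A := ℚ_[p]) (B := K))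
      (MonicCubic.theta_rel hα)
    simp only [map_add, map_mul, map_pow, map_intCast, map_zero, Algebra.TensorProduct.includeRight_apply] at h1
    exact h1
  set cf : Fin 3 → ℚ_[p] := B'.equivFun ρ with hcf
  refine ⟨cf 0, cf 1, cf 2, ?_, ?_⟩
  · -- `ρ ≠ 0` since `z·ρ² = 1`
    intro h0
    have e0 : cf 0 = 0 := congrArg (fun u : ℚ_[p] × ℚ_[p] × ℚ_[p] × ℚ_[p] => u.1) h0
    have e1 : cf 1 = 0 := congrArg (fun u : ℚ_[p] × ℚ_[p] × ℚ_[p] × ℚ_[p] => u.2.1) h0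
    have e2 : cf 2 = 0 := congrArg (fun u : ℚ_[p] × ℚ_[p] × ℚ_[p] × ℚ_[p] => u.2.2.1) h0
    have hcf0 : cf = 0 := by
      funext i; fin_cases i
      · exact e0
      · exact e1
      · exact e2
    have hρ0 : ρ = 0 := by
      rw [← LinearEquiv.symm_apply_apply B'.equivFun ρ, ← hcf, hcf0, map_zero]
    rw [hρ0, zero_pow two_ne_zero, mul_zero] at h
    exact zero_ne_one h
  have hρ : ρ = ev αR (ι (cf 0), ι (cf 1), ι (cf 2)) := by
    rw [hαR, hι, ev_tmul_eq_equivFun_symm hirr hα h3 (cf 0) (cf 1) (cf 2), ← hB']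
    have e : ![cf 0, cf 1, cf 2] = cf := by
      funext i; fin_cases i <;> rfl
    rw [e, hcf, LinearEquiv.symm_apply_apply]
  set q := zsq (a : ℚ_[p]) (b : ℚ_[p]) (c : ℚ_[p]) ((z.1 : ℚ_[p]), (z.2.1 : ℚ_[p]), (z.2.2 : ℚ_[p]))
    (cf 0, cf 1, cf 2) with hq
  have hmap := map_zsq ι (a : ℚ_[p]) (b : ℚ_[p]) (c : ℚ_[p]) ((z.1 : ℚ_[p]), (z.2.1 : ℚ_[p]), (z.2.2 : ℚ_[p]))
    (cf 0, cf 1, cf 2)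
  rw [← hq] at hmap
  simp only [hι, map_intCast] at hmap
  have hL : ((1 : ℚ_[p]) ⊗ₜ[ℚ] evZ α z) * ρ ^ 2 = ev αR (ι q.1, ι q.2.1, ι q.2.2) := by
    rw [one_tmul_evZ, hρ, ← ev_zsq hαR3, hι, hmap]
    simp only [map_intCast]
  have hR : (1 : ℚ_[p] ⊗[ℚ] K) = ev αR (ι 1, ι 0, ι 0) := by
    simp only [ev, map_one, map_zero, zero_mul, add_zero]
  have hcoord : ![q.1, q.2.1, q.2.2] = ![(1 : ℚ_[p]), 0, 0] := by
    apply B'.equivFun.symm.injective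
    rw [hB', ← ev_tmul_eq_equivFun_symm hirr hα h3 q.1 q.2.1 q.2.2,
      ← ev_tmul_eq_equivFun_symm hirr hα h3 (1 : ℚ_[p]) 0 0, ← hι, ← hαR, ← hL, ← hR, h]
  have e1 := congrFun hcoord 1
  have e2 := congrFun hcoord 2
  simp only [Matrix.cons_val_one, Matrix.cons_val_two, Matrix.tail_cons, Matrix.head_cons, Matrix.cons_val] at e1 e2
  have hk : killQ (a : ℚ_[p]) (b : ℚ_[p]) (c : ℚ_[p]) ((z.1 : ℚ_[p]), (z.2.1 : ℚ_[p]), (z.2.2 : ℚ_[p]))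
      (t₁ : ℚ_[p]) (t₂ : ℚ_[p]) (cf 0, cf 1, cf 2, 0) = (q.2.1 + t₁ * 0 ^ 2, q.2.2 + t₂ * 0 ^ 2) := by
    simp only [killQ, hq]
  rw [hk, e1, e2]
  refine Prod.ext ?_ ?_ <;> simp

/-- **Per-place square roots of `1/z` glue**: if `z·ρ_w² = 1` is solvable in `K_w` at every `w ∣ p`, then
`(1 ⊗ z)·ρ² = 1` is solvable in `ℚ_[p] ⊗_ℚ K` (`exists_padicTensorAlgEquiv`).
[cite: CasselsFrohlichANT1967, Ch. II §10 Theorem (10.2)] -/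
theorem exists_tmul_sq_eq_one_of_forall_extension (z : ℤ × ℤ × ℤ)
    (hw : ∀ w : ((Rat.HeightOneSpectrum.primesEquiv (R := 𝓞 ℚ)).symm ⟨p, Fact.out⟩).Extension (𝓞 K),
      ∃ ρw : w.1.adicCompletion K, algebraMap K (w.1.adicCompletion K) (evZ α z) * ρw ^ 2 = 1) :
    ∃ ρ : ℚ_[p] ⊗[ℚ] K, ((1 : ℚ_[p]) ⊗ₜ[ℚ] evZ α z) * ρ ^ 2 = 1 := by
  obtain ⟨Ψ, hΨ⟩ := exists_padicTensorAlgEquiv K p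
  choose ρw hρw using hw
  refine ⟨Ψ.symm (fun w => ρw w), Ψ.injective ?_⟩
  funext w
  rw [map_mul, map_pow, AlgEquiv.apply_symm_apply, map_one, Pi.mul_apply, Pi.pow_apply, Pi.one_apply, hΨ,
    map_one, map_one, mul_one, hρw w]

/-- **Locally trivial classes violate every residue certificate too**: if `z·ρ_w² = 1` is solvable in `K_w`
at every `w ∣ p` (the class of `z` is a square everywhere above `p`), then for every `N` some integer vector
primitive at `p` has `p^N ∣ Q₁, Q₂` (the point of the `2`-covering at `n = 0`).
[cite: Cassels1991LecturesEllipticCurves, §15] [cite: CremonaAlgorithms1997, §3.6] -/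
theorem exists_primitive_killQ_dvd_of_forall_extension_one (hirr : Irreducible (MonicCubic.polyQ a b c))
    (hα : aeval α (MonicCubic.poly a b c) = 0) (h3 : finrank ℚ K = 3)
    (z : ℤ × ℤ × ℤ) (t₁ t₂ : ℤ)
    (hw : ∀ w : ((Rat.HeightOneSpectrum.primesEquiv (R := 𝓞 ℚ)).symm ⟨p, Fact.out⟩).Extension (𝓞 K),
      ∃ ρw : w.1.adicCompletion K, algebraMap K (w.1.adicCompletion K) (evZ α z) * ρw ^ 2 = 1)
    (N : ℕ) :
    ∃ v : ℤ × ℤ × ℤ × ℤ, ¬ ((p : ℤ) ∣ v.1 ∧ (p : ℤ) ∣ v.2.1 ∧ (p : ℤ) ∣ v.2.2.1 ∧ (p : ℤ) ∣ v.2.2.2) ∧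
      (p : ℤ) ^ N ∣ (killQ a b c z t₁ t₂ v).1 ∧ (p : ℤ) ^ N ∣ (killQ a b c z t₁ t₂ v).2 := by
  obtain ⟨ρ, h⟩ := exists_tmul_sq_eq_one_of_forall_extension (α := α) z hw
  obtain ⟨c₀, c₁, c₂, hne, h0⟩ := killQ_eq_zero_of_tmul_sq_eq_one hirr hα h3 z t₁ t₂ ρ h
  exact exists_primitive_killQ_dvd_of_padic_zero a b c z t₁ t₂ (c₀, c₁, c₂, 0) hne h0 N

end One

end Summit.BirchSwinnertonDyer.BirchSwinnertonDyer.Theorems.ShaPrimaryTransferSelmerCubicKill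

end
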